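import Summits.QuantumFields.BalabanUV.Beta.FP.FineSplitJunctionFar
import Summits.QuantumFields.BalabanUV.Beta.FP.FineSplitJunctionBiVertex
import Summits.QuantumFields.BalabanUV.Beta.D1BFx.ContactCount

/-!
# `BalabanUV.Beta.FP.FineSplitJunctionNearFar` — road «FP» for binder row D1, row KER-γ «THE JUNCTION», SOCKET (α0), capstone of the three-file chain
# `FineSplitJunction` (p249309) → `…BiVertex` (p249502) → `…Far`: THE TWO-PIECE TEMPLATE SPLIT of the full fine kernel `F m := fineHessA (Π KPerf Π) (Πᵀ S) Wf`
# — FAR `F·𝟙[Lc^m < ‖s′−s‖∞]` and NEAR `(F − (Lc^m)⁸·PiBF(s′−s))·𝟙[‖s′−s‖∞ ≤ Lc^m]` — with the far entry of the ledger DISCHARGED (`rem_far_perfCol`, modulo the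
# far letter of `F`) and the boundedness of both pieces DISCHARGED (entry bound of `Π KPerf Π`, locality of the jets, (K6) of `PiBF`):
# (ASYMP) for the bi-vertex perfect one-loop kernel ⟸ EXACTLY {H2V-4 letters, colour equation, FAR LETTER of `F`, the NEAR LEDGER as ONE number}

HONEST DEPENDENCY (page 1, mandatory): continuum YM on T⁴ ⇐ BetaPertH ∧ nine spine estimates (0/9 proved); BetaPertH ⇐ (D1) ∧ (D4) ∧
CAP+tail; G-an2-4 gates asym, D1 and NE2/3/4.  HONEST FRAMING (cell contract, verbatim): «discharging `BetaPertH` makes Bałaban's UV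
stability UNCONDITIONAL — a real constructive-QFT result; it is NOT the continuum limit and NOT the Clay problem.»  THIS MODULE is a by-name composition:
`FineSplitJunctionBiVertex.hasym_PiBF_vertex2OfK_of_fineSplit` at the two-element index `Bool` (far ∕ near), `FineSplitJunctionFar.rem_far_perfCol`,
`D1BFx/ContactCount.abs_tadpole_le_of_entryBound` ∕ `abs_bubble_le_of_entryBound` (boundedness of `fineHessA`), `PerfectPolarizationDecay.sextic_PiBF`,
`StepLawKHolds.exists_decays_KPerf_holds`, `AxialDressing.decays_axDressK` ∕ `locStencil_coProj`.  No `def`, no `def … : Prop`, nothing cited, 0 sorry.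
WHAT REMAINS DISPLAYED after it (the road-FP residual for the bi-vertex slot, by type): (i) the admissible-family letters and germ identities of `PiBF`'s vertex
data (row H2V-4) and the colour equation; (ii) the FAR LETTER of the one-shot fine kernel `|F m c e s s′| ≤ (Lc^m)⁸·C_F·‖s′−s‖∞⁻⁶·e^{−(a∕Lc^m)‖s′−s‖∞}` for
`‖s′−s‖∞ > Lc^m`, `C_F`, `a` m-free (rows RHOA-4 (b) ∕ IR-5′ — PRINTED B5 Prop 1.2 input); (iii) THE NEAR LEDGER `∀ m ≥ 1, ∀ S, Σ_{u∈S}‖u‖∞²·|dressedEntryP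
(c a ↦ colH (KPerf…m) (Lc^m) a 0 c) ((F m − (Lc^m)⁸·PiBF(s′−s))·𝟙[‖s′−s‖∞ ≤ Lc^m]) (Lc^m•(−u)) μ ν| ≤ B_near` — ONE number, the whole analytic content of
KER-γ (α2)(γ) + (rem) (the owner's loop-by-loop split of the near window refines it); (iv) per-m locality ∕ coarse covariance of the road's jets `S m`, `Wf m`.
NOT the near ledger, NOT the far letter, NOT N0b-W; hence NOT (ASYMP) for the literal, NOT D1; 0∕4 row-D1 binders; NOT BetaPertH, NOT continuum, NOT Clay.

ABSOLUTE RULE (cell charter, verbatim): «No internally-minted statement may enter as a cited fact. Every hypothesis is either kernel-proved in this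
package or a verbatim quotation of a PUBLISHED theorem with page reference. The manuscript(s) under audit are NOT citable for their own disputed
steps — they are the thing under adjudication; programme-internal (2001/route/tribunal) claims are never citable.»

CONTENT: §1 [folklore] `exists_bound_fineHessA` (an entry-bounded leg, local first-order jets, bi-localised bi-tables ⟹ the full fine kernel is BOUNDED),
`exists_bound_fineHessA_perfect` (at `Π KPerf Π`, `Πᵀ S`); §2 [folklore] `fineSplit_near_far` (the two-piece split is an identity, pointwise);
§3 [our object] **`hasym_PiBF_vertex2OfK_of_near_far`**.
Provenance: D1 formalisation swarm LEAF PROVER 01, unit `b2b-balaban-beta-d1-formalise-leaf-01` gen 11, 2026-08-21, road FP row KER-γ; «not in print; our bookkeeping».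
-/

noncomputable section

namespace Summit.QuantumFields.BalabanUV.Beta.FP.FineSplitJunctionNearFar

open Finset
open scoped BigOperators
open Literature.MathematicalPhysics.QuantumFieldTheory.Balaban1983to89
open Literature.MathematicalPhysics.QuantumFieldTheory.Balaban1983to89.Beta
open Literature.MathematicalPhysics.QuantumFieldTheory.Balaban1983to89.Beta.BubbleTransfer (c4)
open Literature.MathematicalPhysics.QuantumFieldTheory.Balaban1983to89.B12Normalization (stepBal)
open B12Sec2to5 (l1 l1_nonneg)
open PolarizationSign (reflSign)
open ExpKernelCalculus (Site MKer Decays BiLoc comp shiftK tadpole bubble Zl Zl_nonneg)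
open OneStepResolventKernel (Fib LocStencil)
open OneStepKernelFamily (colH)
open KernelWard (divV divW)
open KernelReflection (LegMap refK bondRefl)
open DyadicShell (Pt supNorm)
open LeadingCoefficient (kappaBal)
open AxialProjector (coProj)
open AxialDressing (axDressK decays_axDressK locStencil_coProj)
open SecondOrderResponse (vertex2OfK)
open Summit.QuantumFields.BalabanUV.Beta.GAN24.CombesThomas (sfStep smStep)
open Summit.QuantumFields.BalabanUV.Beta.D1BFx.MomentTransferPeriodicEntry (EKer₂ dressedEntryP)
open Summit.QuantumFields.BalabanUV.Beta.D1BFx.DressedTablesLeg (tadpoleTableA_apply bubbleTableA_apply)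
open Summit.QuantumFields.BalabanUV.Beta.D1BFx.ReducedKernelSandwichLeg (fineHessA fineHessA_apply)
open Summit.QuantumFields.BalabanUV.Beta.D1BFx.ContactCount (abs_tadpole_le_of_entryBound abs_bubble_le_of_entryBound)
open Summit.QuantumFields.BalabanUV.Beta.FP.PerfectObjectsT (KPerf TPerfOf)
open Summit.QuantumFields.BalabanUV.Beta.FP.HorizontalBookkeeping (truncK truncK_apply)
open Summit.QuantumFields.BalabanUV.Beta.FP.WilsonCubicGerm (cubicGermOf)
open Summit.QuantumFields.BalabanUV.Beta.FP.GhostCubicGerm (cubicGermOfSc)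
open Summit.QuantumFields.BalabanUV.Beta.FP.BubbleGermValue (bfGerm ghostGerm)
open Summit.QuantumFields.BalabanUV.Beta.FP.PerfectPolarization (Pker G0ker PiBF)
open Summit.QuantumFields.BalabanUV.Beta.FP.PerfectPolarizationDecay (sextic_PiBF)
open Summit.QuantumFields.BalabanUV.Beta.FP.StepLawKHolds (exists_decays_KPerf_holds)
open Summit.QuantumFields.BalabanUV.Beta.FP.FineSplitJunctionBiVertex (hasym_PiBF_vertex2OfK_of_fineSplit)
open Summit.QuantumFields.BalabanUV.Beta.FP.FineSplitJunctionFar (rem_far_perfCol)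

/-! ## §1 The full fine kernel is bounded -/

section Bounded

/-- [folklore] **THE FULL FINE KERNEL IS BOUNDED**: an entry-bounded leg `A` (`|A x y a b| ≤ C₀`), first-order jets bi-localised at `(u,u)` with `(Cs, δs)`,
`δs > 0`, bi-tables bi-localised at `(u,u′)` with `(C2, δ2)`, `δ2 > 0` ⟹ `∃ A_F, ∀ κ′ λ′ u u′, |fineHessA A S Wf κ′ λ′ u u′| ≤ A_F`
(`ContactCount.abs_tadpole_le_of_entryBound` + `abs_bubble_le_of_entryBound`; the constant is uniform in the bond pair). -/
theorem exists_bound_fineHessA {A : MKer 4 (Fib 3)} {C₀ : ℝ} (hC₀ : 0 ≤ C₀) (hA : ∀ x y a b, |A x y a b| ≤ C₀)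
    {S : Fin 4 → Site 4 → MKer 4 (Fib 3)} {Cs δs : ℝ} (hS : ∀ κ u, BiLoc (S κ u) u u Cs δs) (hδs : 0 < δs)
    {Wf : Fin 4 → Site 4 → Fin 4 → Site 4 → MKer 4 (Fib 3)} {C2 δ2 : ℝ} (hW : ∀ κ' u l' u', BiLoc (Wf κ' u l' u') u u' C2 δ2) (hδ2 : 0 < δ2) :
    ∃ AF : ℝ, ∀ (κ' l' : Fin 4) (u u' : Site 4), |fineHessA A S Wf κ' l' u u'| ≤ AF := by
  refine ⟨(1 / 2 : ℝ) * ((Fintype.card (Fib 3) : ℝ) * ((Fintype.card (Fib 3) : ℝ) * (C₀ * C2) * Zl 4 δ2) * Zl 4 δ2) +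
    (1 / 2 : ℝ) * ((Fintype.card (Fib 3) : ℝ) * ((Fintype.card (Fib 3) : ℝ) *
      (((Fintype.card (Fib 3) : ℝ) * (C₀ * Cs) * Zl 4 δs) * ((Fintype.card (Fib 3) : ℝ) * (C₀ * Cs) * Zl 4 δs)) * Zl 4 δs) * Zl 4 δs),
    fun κ' l' u u' => ?_⟩
  rw [fineHessA_apply, tadpoleTableA_apply, bubbleTableA_apply]
  have ht := abs_tadpole_le_of_entryBound hC₀ hA (hW κ' u l' u') hδ2
  have hb := abs_bubble_le_of_entryBound hC₀ hA (hS κ' u) (hS l' u') hδs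
  calc |(1 / 2 : ℝ) * tadpole A (Wf κ' u l' u') + -(1 / 2 : ℝ) * bubble A (S κ' u) (S l' u')|
      ≤ |(1 / 2 : ℝ) * tadpole A (Wf κ' u l' u')| + |-(1 / 2 : ℝ) * bubble A (S κ' u) (S l' u')| := abs_add_le _ _
    _ = (1 / 2 : ℝ) * |tadpole A (Wf κ' u l' u')| + (1 / 2 : ℝ) * |bubble A (S κ' u) (S l' u')| := by
        rw [abs_mul, abs_mul, abs_neg, abs_of_pos (by norm_num : (0 : ℝ) < 1 / 2)]
    _ ≤ _ := add_le_add (mul_le_mul_of_nonneg_left ht (by norm_num)) (mul_le_mul_of_nonneg_left hb (by norm_num))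

variable {Lc : ℕ} [NeZero Lc]

/-- [folklore] **… AT THE PERFECT DATA**: `K := KPerf…m` (decay from the tree), `n := Lc^m`, ANY local first-order stencils `S` and bi-localised bi-tables `Wf`
(rates `> 0`) ⟹ the full fine kernel `fineHessA (Π K Π) (Πᵀ S) Wf` is bounded (entry bound of `Π K Π` = its decay constant; `Πᵀ S` local by `locStencil_coProj`). -/
theorem exists_bound_fineHessA_perfect (hLc : 2 ≤ Lc) {m : ℕ} (hm : 1 ≤ m)
    {S : Fin (3 + 1) → (Fin (3 + 1) → ℤ) → MKer (3 + 1) (Fib 3)} {Cs δs : ℝ} (hS : LocStencil S Cs δs) (hδs : 0 < δs)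
    {Wf : Fin (3 + 1) → (Fin (3 + 1) → ℤ) → Fin (3 + 1) → (Fin (3 + 1) → ℤ) → MKer (3 + 1) (Fib 3)} {C2 δ2 : ℝ}
    (hW : ∀ κ' u l' u', BiLoc (Wf κ' u l' u') u u' C2 δ2) (hδ2 : 0 < δ2) :
    ∃ AF : ℝ, ∀ (κ' l' : Fin 4) (u u' : Site 4),
      |fineHessA (axDressK (Lc ^ m) (KPerf (d := 3) Lc (sfStep Lc) (smStep 3 Lc) m)) (coProj (Lc ^ m) S) Wf κ' l' u u'| ≤ AF := by
  have hn1 : 1 ≤ Lc ^ m := Nat.one_le_pow _ _ (by omega)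
  obtain ⟨CK, δK, hδK, hK⟩ := exists_decays_KPerf_holds hLc hm
  have hA := decays_axDressK hn1 hK hδK.le
  have hC₀ : 0 ≤ AxialDressing.cAx 3 (Lc ^ m) δK * (AxialDressing.cAx 3 (Lc ^ m) δK * CK) := hA.nonneg (Sum.inl 0)
  have hAb : ∀ x y a b, |axDressK (Lc ^ m) (KPerf (d := 3) Lc (sfStep Lc) (smStep 3 Lc) m) x y a b|
      ≤ AxialDressing.cAx 3 (Lc ^ m) δK * (AxialDressing.cAx 3 (Lc ^ m) δK * CK) := fun x y a b =>
    (hA x y a b).trans (mul_le_of_le_one_right hC₀ (Real.exp_le_one_iff.mpr (by nlinarith [l1_nonneg (x - y)])))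
  exact exists_bound_fineHessA hC₀ hAb (fun κ u => locStencil_coProj hn1 hS hδs.le κ u) hδs hW hδ2

end Bounded

/-! ## §2 The two-piece split is an identity -/

section Split

/-- [folklore] **THE NEAR∕FAR TEMPLATE SPLIT**, pointwise: for any two-point table `F`, kernel `P`, scalar `r` and threshold `N`,
`F s s′ − r·truncK P N (s′−s) = [F·𝟙_{N < ‖s′−s‖∞}] + [(F − r·P(s′−s))·𝟙_{‖s′−s‖∞ ≤ N}]`, written as the `Bool`-indexed sum (`true` = far). -/
theorem fineSplit_near_far (F : EKer₂ 4) (P : DressedMomentNormalisation.EKer 4) (r : ℝ) (N : ℕ) (c e : Fin 4) (s s' : Pt) :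
    F c e s s' - r * truncK P N c e (s' - s)
      = ∑ i ∈ (Finset.univ : Finset Bool),
          (fun (i : Bool) (c e : Fin 4) (s s' : Pt) =>
            cond i (if N < supNorm (s' - s) then F c e s s' else 0)
              (if supNorm (s' - s) ≤ N then F c e s s' - r * P c e (s' - s) else 0)) i c e s s' := by
  rw [Fintype.sum_bool]
  simp only [cond_true, cond_false, truncK_apply]
  by_cases h : supNorm (s' - s) ≤ N
  · rw [if_pos h, if_neg (not_lt.mpr h), if_pos h]; ring
  · rw [if_neg h, if_pos (not_le.mp h), if_neg h]; ring

end Split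

/-! ## §3 (ASYMP) for the bi-vertex perfect one-loop kernel from the far letter and the near ledger -/

section NearFar

variable {Lc : ℕ} [NeZero Lc]

/-- **(ASYMP) FOR THE PERFECT ONE-LOOP KERNEL WITH THE BI-VERTEX SLOT ⟸ H2V-4 LETTERS ∧ COLOUR EQUATION ∧ FAR LETTER ∧ NEAR LEDGER** [our object].
`T m := TPerfOf (Lc^m) (KPerf…m) (S m) (vertex2OfK (KPerf…m) (Lc^m) (Wf m))`, `F m := fineHessA (axDressK (Lc^m) (KPerf…m)) (coProj (Lc^m) (S m)) (Wf m)`.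
Hypotheses beyond `FineSplitJunctionBiVertex.hasym_PiBF_vertex2OfK_of_fineSplit`'s H2V-4∕colour∕jet letters: the FAR LETTER `hfar` of `F m` outside the
window (constant `(Lc^m)⁸·C_F`, rate `a∕Lc^m`, `C_F ≥ 0`, `a > 0` m-free) and the NEAR LEDGER `hnear` (one number `B_near`).  The fine split is the two-piece
template `fineSplit_near_far`; the far entry of the ledger is `rem_far_perfCol`; boundedness of the pieces is `exists_bound_fineHessA_perfect` + (K6).
Conclusion: `∃ U ≥ 0, ∃ Cg, ∀ m ≥ 1, |secondMoment (T m) μ ν − m·stepBal N Lc| ≤ (U + B_near) + Cg` (the far constant absorbed in `U`). -/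
theorem hasym_PiBF_vertex2OfK_of_near_far (hLc : 2 ≤ Lc) (wg wgh : ℝ)
    {V : Fin 4 → Site 4 → MKer 4 (Fib 3)} {W : Fin 4 → Site 4 → Fin 4 → Site 4 → MKer 4 (Fib 3)}
    {v : Fin 4 → Site 4 → MKer 4 Unit} {w : Fin 4 → Site 4 → Fin 4 → Site 4 → MKer 4 Unit} {Cv Cw Cx Cw' Cx' CwL CwL' cQ δ : ℝ} (hδ : 0 < δ)
    -- admissible-family letters, gluon sector
    (hV : ∀ (μ : Fin 4) (y : Site 4), BiLoc (V μ y) y y Cv δ) (hW : ∀ (μ : Fin 4) (y : Site 4) (ν : Fin 4) (y' : Site 4), BiLoc (W μ y ν y') y y' Cw δ)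
    (hcovV : ∀ (μ : Fin 4) (y t : Site 4), V μ (y + t) = shiftK (-t) (V μ y))
    (hcovW : ∀ (μ : Fin 4) (y : Site 4) (ν : Fin 4) (y' t : Site 4), W μ (y + t) ν (y' + t) = shiftK (-t) (W μ y ν y'))
    (X : Site 4 → MKer 4 (Fib 3)) (hX : ∀ y, BiLoc (X y) y y Cx δ)
    (hW1 : ∀ y, comp (comp Pker (divV V y)) Pker = comp Pker (X y) - comp (X y) Pker)
    (hW2 : ∀ y ν y', divW W y ν y' = comp (X y) (V ν y') - comp (V ν y') (X y))
    (hreflP : ∀ α : Fin 4, ∃ Φα : LegMap 4 (Fib 3), refK Φα Pker = Pker ∧ ∃ c : ℤ,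
      (∀ μ y, V μ (bondRefl α c μ y) = reflSign α μ • refK Φα (V μ y)) ∧
      (∀ μ y ν y', W μ (bondRefl α c μ y) ν (bondRefl α c ν y') = (reflSign α μ * reflSign α ν) • refK Φα (W μ y ν y')))
    (h0V : ∀ (lam α β : Fin 4), ∑' p : Pt × Pt, V lam 0 p.1 p.2 (Sum.inl α) (Sum.inl β) = 0)
    (hgermV : cubicGermOf V = cQ • bfGerm)
    (hWloc : ∀ (μ ν : Fin 4) (z : Pt), BiLoc (W μ 0 ν z) 0 z (CwL * Real.exp (-δ * l1 z)) δ)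
    -- admissible-family letters, ghost sector
    (hv : ∀ (μ : Fin 4) (y : Site 4), BiLoc (v μ y) y y Cv δ) (hw : ∀ (μ : Fin 4) (y : Site 4) (ν : Fin 4) (y' : Site 4), BiLoc (w μ y ν y') y y' Cw' δ)
    (hcovv : ∀ (μ : Fin 4) (y t : Site 4), v μ (y + t) = shiftK (-t) (v μ y))
    (hcovw : ∀ (μ : Fin 4) (y : Site 4) (ν : Fin 4) (y' t : Site 4), w μ (y + t) ν (y' + t) = shiftK (-t) (w μ y ν y'))
    (Xg : Site 4 → MKer 4 Unit) (hXg : ∀ y, BiLoc (Xg y) y y Cx' δ)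
    (hW1g : ∀ y, comp (comp G0ker (divV v y)) G0ker = comp G0ker (Xg y) - comp (Xg y) G0ker)
    (hW2g : ∀ y ν y', divW w y ν y' = comp (Xg y) (v ν y') - comp (v ν y') (Xg y))
    (hreflG : ∀ α : Fin 4, ∃ Ψα : LegMap 4 Unit, refK Ψα G0ker = G0ker ∧ ∃ c : ℤ,
      (∀ μ y, v μ (bondRefl α c μ y) = reflSign α μ • refK Ψα (v μ y)) ∧
      (∀ μ y ν y', w μ (bondRefl α c μ y) ν (bondRefl α c ν y') = (reflSign α μ * reflSign α ν) • refK Ψα (w μ y ν y')))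
    (h0v : ∀ lam : Fin 4, ∑' p : Pt × Pt, v lam 0 p.1 p.2 () () = 0)
    (hgermv : cubicGermOfSc v = ghostGerm)
    (hwloc : ∀ (μ ν : Fin 4) (z : Pt), BiLoc (w μ 0 ν z) 0 z (CwL' * Real.exp (-δ * l1 z)) δ)
    -- the colour weights and the entry
    {N : ℝ} (hn : (40 * wg * (1 / 4 : ℝ) * (c4 * cQ) ^ 2 - wgh * (-(1 / 2 : ℝ)) * c4 ^ 2) / 3 = kappaBal N)
    {μ ν : Fin 4} (hμν : μ ≠ ν)
    -- the road's first-order stencils and bi-tables at every `m` (letters per `m`, constants free)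
    {S : ℕ → Fin (3 + 1) → (Fin (3 + 1) → ℤ) → MKer (3 + 1) (Fib 3)}
    (hS : ∀ m : ℕ, 1 ≤ m → ∃ Cs δs : ℝ, 0 < δs ∧ LocStencil (S m) Cs δs ∧
      ∀ κ u t, S m κ (u + ((Lc ^ m : ℕ) : ℤ) • t) = shiftK (-(((Lc ^ m : ℕ) : ℤ) • t)) (S m κ u))
    {Wf : ℕ → Fin (3 + 1) → (Fin (3 + 1) → ℤ) → Fin (3 + 1) → (Fin (3 + 1) → ℤ) → MKer (3 + 1) (Fib 3)}
    (hWf : ∀ m : ℕ, 1 ≤ m → ∃ C2 δ2 : ℝ, 0 < δ2 ∧ (∀ κ' u l' u', BiLoc (Wf m κ' u l' u') u u' C2 δ2) ∧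
      ∀ κ' u l' u' t, Wf m κ' (u + ((Lc ^ m : ℕ) : ℤ) • t) l' (u' + ((Lc ^ m : ℕ) : ℤ) • t)
        = shiftK (-(((Lc ^ m : ℕ) : ℤ) • t)) (Wf m κ' u l' u'))
    -- the FAR LETTER of the full fine kernel (m-free shape) and the NEAR LEDGER (one number)
    {CF a : ℝ} (hCF : 0 ≤ CF) (ha : 0 < a)
    (hfar : ∀ m : ℕ, 1 ≤ m → ∀ (c e : Fin 4) (s s' : Pt), Lc ^ m < supNorm (s' - s) →
      |fineHessA (axDressK (Lc ^ m) (KPerf (d := 3) Lc (sfStep Lc) (smStep 3 Lc) m)) (coProj (Lc ^ m) (S m)) (Wf m) c e s s'|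
        ≤ ((Lc ^ m : ℕ) : ℝ) ^ 8 * (CF / (supNorm (s' - s) : ℝ) ^ 6 * Real.exp (-(a / ((Lc ^ m : ℕ) : ℝ)) * (supNorm (s' - s) : ℝ))))
    {Bnear : ℝ}
    (hnear : ∀ m : ℕ, 1 ≤ m → ∀ S' : Finset Pt, ∑ u ∈ S', (supNorm u : ℝ) ^ 2 *
      |dressedEntryP (fun c a' => colH (KPerf (d := 3) Lc (sfStep Lc) (smStep 3 Lc) m) (Lc ^ m) a' 0 c)
        (fun c e s s' => if supNorm (s' - s) ≤ Lc ^ m then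
          fineHessA (axDressK (Lc ^ m) (KPerf (d := 3) Lc (sfStep Lc) (smStep 3 Lc) m)) (coProj (Lc ^ m) (S m)) (Wf m) c e s s'
            - ((Lc ^ m : ℕ) : ℝ) ^ 8 * PiBF wg wgh V W v w c e (s' - s) else 0)
        (((Lc ^ m : ℕ) : ℤ) • (-u)) μ ν| ≤ Bnear) :
    ∃ U : ℝ, 0 ≤ U ∧ ∃ Cg : ℝ, ∀ m : ℕ, 1 ≤ m →
      |B12Beta.secondMoment (TPerfOf (Lc ^ m) (KPerf (d := 3) Lc (sfStep Lc) (smStep 3 Lc) m) (S m)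
          (vertex2OfK (KPerf (d := 3) Lc (sfStep Lc) (smStep 3 Lc) m) (Lc ^ m) (Wf m))) μ ν - (m : ℝ) * stepBal N Lc|
        ≤ (U + Bnear) + Cg := by
  -- abbreviations (terms, not definitions)
  set K : ℕ → MKer (3 + 1) (Fib 3) := fun m => KPerf (d := 3) Lc (sfStep Lc) (smStep 3 Lc) m with hKdef
  set F : ℕ → EKer₂ 4 := fun m => fineHessA (axDressK (Lc ^ m) (K m)) (coProj (Lc ^ m) (S m)) (Wf m) with hFdef
  set G : Bool → ℕ → EKer₂ 4 := fun i m c e s s' =>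
    cond i (if Lc ^ m < supNorm (s' - s) then F m c e s s' else 0)
      (if supNorm (s' - s) ≤ Lc ^ m then F m c e s s' - ((Lc ^ m : ℕ) : ℝ) ^ 8 * PiBF wg wgh V W v w c e (s' - s) else 0) with hGdef
  -- (K6): a bound of `PiBF`
  have hLoc : LocStencil V Cv δ := fun κ u => hV κ u
  have hcovV0 : ∀ (lam : Fin 4) (u : Site 4), V lam u = shiftK (-u) (V lam 0) := fun lam u => by
    have h := hcovV lam 0 u; rwa [zero_add] at h
  have hcovv0 : ∀ (lam : Fin 4) (u : Site 4), v lam u = shiftK (-u) (v lam 0) := fun lam u => by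
    have h := hcovv lam 0 u; rwa [zero_add] at h
  obtain ⟨CP, hCP0, hKP⟩ := sextic_PiBF (wg := wg) (wgh := wgh) (cQ := cQ) hδ hLoc hcovV0 h0V hgermV hWloc hv hcovv0 h0v hgermv hwloc
  have hPb : ∀ (c e : Fin 4) (t : Pt), |PiBF wg wgh V W v w c e t| ≤ CP := fun c e t =>
    (hKP c e t).trans (div_le_self hCP0 (one_le_pow₀ (by
      have : (0 : ℝ) ≤ (supNorm t : ℝ) := Nat.cast_nonneg _
      linarith)))
  -- the far entry of the ledger, m-free
  obtain ⟨Bfar, hBfar0, hBfar⟩ := rem_far_perfCol (Lc := Lc) hLc (G := G true) (μ := μ) (ν := ν) hCF ha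
    (fun m hm c e s s' hfs => by
      show |(if Lc ^ m < supNorm (s' - s) then F m c e s s' else 0)| ≤ _
      rw [if_pos hfs]; exact hfar m hm c e s s' hfs)
    (fun m hm c e s s' hns => by
      show (if Lc ^ m < supNorm (s' - s) then F m c e s s' else 0) = 0
      rw [if_neg (not_lt.mpr hns)])
  -- the composition
  obtain ⟨U₀, hU₀, Cg, hmain⟩ := hasym_PiBF_vertex2OfK_of_fineSplit hLc wg wgh hδ hV hW hcovV hcovW X hX hW1 hW2 hreflP h0V hgermV hWloc
    hv hw hcovv hcovw Xg hXg hW1g hW2g hreflG h0v hgermv hwloc hn hμν hS hWf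
    (Finset.univ : Finset Bool) (G := G) (B := fun i => cond i Bfar Bnear)
    (fun m hm c e s s' => by
      have h := fineSplit_near_far (F m) (PiBF wg wgh V W v w) (((Lc ^ m : ℕ) : ℝ) ^ 8) (Lc ^ m) c e s s'
      simpa only [hGdef] using h)
    (fun i _ m hm c e => by
      obtain ⟨Cs, δs, hδs, hSm, -⟩ := hS m hm
      obtain ⟨C2, δ2, hδ2, hWm, -⟩ := hWf m hm
      obtain ⟨AF, hAF⟩ := exists_bound_fineHessA_perfect (Lc := Lc) hLc hm hSm hδs hWm hδ2
      have hAF0 : 0 ≤ AF := (abs_nonneg _).trans (hAF c e 0 0)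
      refine ⟨AF + ((Lc ^ m : ℕ) : ℝ) ^ 8 * CP, fun s s' => ?_⟩
      cases i with
      | true =>
        show |(if Lc ^ m < supNorm (s' - s) then F m c e s s' else 0)| ≤ _
        split_ifs
        · exact (hAF c e s s').trans (le_add_of_nonneg_right (by positivity))
        · rw [abs_zero]; positivity
      | false =>
        show |(if supNorm (s' - s) ≤ Lc ^ m then F m c e s s' - ((Lc ^ m : ℕ) : ℝ) ^ 8 * PiBF wg wgh V W v w c e (s' - s) else 0)| ≤ _
        split_ifs
        · refine (abs_sub _ _).trans (add_le_add (hAF c e s s') ?_)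
          rw [abs_mul, abs_pow, Nat.abs_cast]
          exact mul_le_mul_of_nonneg_left (hPb c e _) (by positivity)
        · rw [abs_zero]; positivity)
    (fun i _ m hm S' => by
      cases i with
      | true => exact hBfar m hm S'
      | false => exact hnear m hm S')
  refine ⟨U₀ + Bfar, add_nonneg hU₀ hBfar0, Cg, fun m hm => ?_⟩
  have h := hmain m hm
  rw [Fintype.sum_bool] at h
  simp only [cond_true, cond_false] at h
  linarith

end NearFar

end Summit.QuantumFields.BalabanUV.Beta.FP.FineSplitJunctionNearFar

end
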